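import Literature.MathematicalPhysics.QuantumLattice.FermionQuasiFreeDynamics
import Literature.MathematicalPhysics.QuantumLattice.HubbardFermiLiquid
import HarnessLib

/-!
# The finite-temperature time-ordered two-point (Schwinger) function: imaginary-time evolution,
KMS antiperiodicity, the free propagator, the Hubbard torus

Topic `MathematicalPhysics/QuantumLattice`; programme under the tree's fact `bgm_two_point_limit`
(`HubbardFermiLiquid.lean`). Benfatto–Giuliani–Mastropietro (Ann. Henri Poincaré 7 (2006) 809,
§1.2, p. 2 of the held arXiv text) define the imaginary-time fields `a^±_𝐱 = e^{Hx₀} a^±_{x⃗} e^{-Hx₀}`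
(1.2), the finite-temperature Schwinger functions `S = Tr[e^{-βH} T(⋯)]/Tr e^{-βH}` with the
fermionic time ordering `T` (1.3) ("creation operators precede the annihilation operators" at equal
times, footnote 1), the two-point function `S(𝐱-𝐲) = S(𝐱,σ,-;𝐲,σ,+)` and its free value (1.4), and
note that "`S₀(𝐱)` is a function of `x₀ ∈ ℝ` antiperiodic of period `β`". The tree's shadow fact is
stated for the EQUAL-TIME two-point function only (`hubbardThermalTwoPoint`); this file supplies
the time-dependent object of BGM's Theorem 1.1 in finite volume and proves its structural
properties. Everything is PROVED:

* `Matrix.imagTimeEvolve H s X = e^{sH} X e^{-sH}` (complex `s`; the real-time Heisenberg dynamics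
  `heisenbergEvolution` of `LocalDynamics.lean` is the case `s = it`): group law, multiplicativity,
  linearity; invariance of the Gibbs state `⟨X(s)⟩ = ⟨X⟩`, time-translation invariance of two-time
  correlations `⟨X(s)Y(t)⟩ = ⟨X(s-t)Y⟩`, and the **KMS condition** `⟨XY⟩ = ⟨Y(β)X⟩`
  (Bratteli–Robinson II §5.3.1);
* `Matrix.schwingerTwoPoint β H A B x₀ y₀ = ⟨T A(x₀)B(y₀)⟩` with the fermionic sign (BGM (1.2)–(1.3)):
  equal-time value `-⟨BA⟩` (`schwingerTwoPoint_self`), dependence on `x₀ - y₀` only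
  (`schwingerTwoPoint_eq_sub`), **antiperiodicity** `S(x₀-β, y₀) = -S(x₀, y₀)` for
  `0 < x₀ - y₀ ≤ β` (`schwingerTwoPoint_sub_period`);
* the ideal Fermi gas `dΓ(h)`: `schwingerTwoPoint_dGamma_annihilation_creation` — BGM's free
  propagator (1.4) in position space and finite volume, both time orderings, from the two-time
  Fermi matrices of `FermionQuasiFreeDynamics.lean`;
* the 2D Hubbard torus: `hubbardSchwingerTwoPoint β U μ L x₀ x⃗ σ y₀ y⃗ σ'` = BGM's
  `S^{β,L}(𝐱,σ,-;𝐲,σ',+)` in the normalisation of `HubbardFermiLiquid.lean` (hopping `1`, sites of `ℤ²`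
  mod `L`), with `hubbardSchwingerTwoPoint_self` (`= -hubbardThermalTwoPoint β U μ L y⃗ x⃗ σ' σ` at
  equal times), `_eq_sub`, `_sub_period`, and the `U = 0` closed form
  `hubbardSchwingerTwoPoint_zero_interaction`.

Not here: bounds `|S| ≤ 1` at unequal times (matrix Hölder), the Fourier transform `Ŝ(𝐤)` over
`𝒟_{β,L}` and the `L → ∞` limit — the objects of (1.10)–(1.12).

## Mathlib / tree search

Mathlib: `Matrix.exp_add_of_commute`, `Matrix.trace_mul_cycle/_comm`; no KMS / imaginary-time
two-point function (`lean search 'schwinger|KMS|imaginaryTime'`: nothing relevant). Tree: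
`FinDimSpectrum` (`Matrix.gibbsState`, `gibbsWeight`, `thermalCorr`), `LocalDynamics`
(`heisenbergEvolution`, real time), `FermionQuasiFreeDynamics` (two-time Fermi matrices),
`HubbardFermiLiquid` (`hubbardThermalTwoPoint`), `HubbardModel` (`hubbardTorusWith`).

## References

* G. Benfatto, A. Giuliani, V. Mastropietro, Ann. Henri Poincaré 7 (2006) 809–898, §1.2
  (1.2)–(1.4) and footnote 1 (arXiv:cond-mat/0507686, p. 2). [BenfattoGiulianiMastropietro2006]
* O. Bratteli, D. W. Robinson, *Operator Algebras and Quantum Statistical Mechanics II*, 2nd ed.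
  (Springer 1997), §5.3.1 (KMS condition; Gibbs states of finite systems are `β`-KMS), §5.2.4
  (ideal Fermi gas). [BratteliRobinsonII1997]
-/

noncomputable section

open NormedSpace Matrix Finset
open scoped ComplexOrder

namespace Matrix

variable {n : Type*} [Fintype n] [DecidableEq n]

/-! ### Imaginary-time evolution -/

/-- (Dot-notation extension of Mathlib's `Matrix`.) The **imaginary-time (Euclidean Heisenberg)
evolution** of an operator under `H`: `X(s) = e^{sH} X e^{-sH}` (`s ∈ ℂ`; BGM's fields
`a^±_𝐱 = e^{Hx₀} a^±_{x⃗} e^{-Hx₀}`, eq. (1.2)). [cite: BenfattoGiulianiMastropietro2006, §1.2 (1.2)] -/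
def imagTimeEvolve (H : Matrix n n ℂ) (s : ℂ) (X : Matrix n n ℂ) : Matrix n n ℂ :=
  exp (s • H) * X * exp (-(s • H))

/-- `X(s)` unfolded. [folklore] -/
theorem imagTimeEvolve_eq (H : Matrix n n ℂ) (s : ℂ) (X : Matrix n n ℂ) :
    imagTimeEvolve H s X = exp (s • H) * X * exp (-(s • H)) := rfl

/-- `e^{-sH} e^{sH} = 1`. [folklore] -/
theorem exp_neg_smul_mul_exp_smul (H : Matrix n n ℂ) (s : ℂ) : exp (-(s • H)) * exp (s • H) = 1 := by
  rw [← Matrix.exp_add_of_commute _ _ (Commute.refl (s • H)).neg_left, neg_add_cancel, exp_zero]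

/-- `e^{sH} e^{-sH} = 1`. [folklore] -/
theorem exp_smul_mul_exp_neg_smul (H : Matrix n n ℂ) (s : ℂ) : exp (s • H) * exp (-(s • H)) = 1 := by
  rw [← Matrix.exp_add_of_commute _ _ (Commute.refl (s • H)).neg_right, add_neg_cancel, exp_zero]

/-- `X(0) = X`. [folklore] -/
@[simp] theorem imagTimeEvolve_zero (H X : Matrix n n ℂ) : imagTimeEvolve H 0 X = X := by
  simp [imagTimeEvolve]

/-- `1(s) = 1`. [folklore] -/
@[simp] theorem imagTimeEvolve_one (H : Matrix n n ℂ) (s : ℂ) : imagTimeEvolve H s 1 = 1 := by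
  simp [imagTimeEvolve, exp_smul_mul_exp_neg_smul]

/-- The evolution is a group: `X(s + t) = (X(t))(s)`. [folklore] -/
theorem imagTimeEvolve_add (H : Matrix n n ℂ) (s t : ℂ) (X : Matrix n n ℂ) :
    imagTimeEvolve H (s + t) X = imagTimeEvolve H s (imagTimeEvolve H t X) := by
  simp only [imagTimeEvolve]
  rw [add_smul, Matrix.exp_add_of_commute _ _ (((Commute.refl H).smul_left s).smul_right t), neg_add,
    add_comm (-(s • H)), Matrix.exp_add_of_commute (-(t • H)) (-(s • H))
      ((((Commute.refl H).smul_left t).smul_right s).neg_left.neg_right)]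
  simp only [mul_assoc]

/-- The evolution is multiplicative: `(XY)(s) = X(s) Y(s)`. [folklore] -/
theorem imagTimeEvolve_mul (H : Matrix n n ℂ) (s : ℂ) (X Y : Matrix n n ℂ) :
    imagTimeEvolve H s (X * Y) = imagTimeEvolve H s X * imagTimeEvolve H s Y := by
  simp only [imagTimeEvolve]
  rw [show exp (s • H) * X * exp (-(s • H)) * (exp (s • H) * Y * exp (-(s • H))) =
      exp (s • H) * X * (exp (-(s • H)) * exp (s • H)) * Y * exp (-(s • H)) by
        simp only [mul_assoc], exp_neg_smul_mul_exp_smul, mul_one]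
  simp only [mul_assoc]

/-- The evolution is linear. [folklore] -/
theorem imagTimeEvolve_add_op (H : Matrix n n ℂ) (s : ℂ) (X Y : Matrix n n ℂ) :
    imagTimeEvolve H s (X + Y) = imagTimeEvolve H s X + imagTimeEvolve H s Y := by
  simp only [imagTimeEvolve, Matrix.mul_add, Matrix.add_mul]

/-- The evolution is homogeneous. [folklore] -/
theorem imagTimeEvolve_smul (H : Matrix n n ℂ) (s c : ℂ) (X : Matrix n n ℂ) :
    imagTimeEvolve H s (c • X) = c • imagTimeEvolve H s X := by
  simp only [imagTimeEvolve, Matrix.mul_smul, Matrix.smul_mul]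

/-- The Gibbs weight commutes with the evolution operators. [folklore] -/
theorem gibbsWeight_mul_exp_smul_comm (β : ℝ) (H : Matrix n n ℂ) (s : ℂ) :
    gibbsWeight β H * exp (s • H) = exp (s • H) * gibbsWeight β H := by
  rw [gibbsWeight]
  exact (Matrix.exp_add_of_commute _ _ (((Commute.refl H).smul_left _).smul_right s)).symm.trans
    ((add_comm (-(β : ℂ) • H) (s • H)) ▸ Matrix.exp_add_of_commute _ _
      (((Commute.refl H).smul_left s).smul_right _))

/-- **Invariance of the Gibbs state under the imaginary-time evolution**: `⟨X(s)⟩ = ⟨X⟩`.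
Bratteli–Robinson II §5.3.1 (Gibbs states are `τ`-invariant). [folklore] -/
theorem gibbsState_imagTimeEvolve (β : ℝ) (H : Matrix n n ℂ) (s : ℂ) (X : Matrix n n ℂ) :
    gibbsState β H (imagTimeEvolve H s X) = gibbsState β H X := by
  simp only [gibbsState_apply, imagTimeEvolve]
  congr 1
  rw [← Matrix.mul_assoc, ← Matrix.mul_assoc, gibbsWeight_mul_exp_smul_comm, Matrix.trace_mul_cycle,
    ← Matrix.mul_assoc, exp_neg_smul_mul_exp_smul, Matrix.one_mul]

/-- **Time-translation invariance of two-time correlations**: `⟨X(s) Y(t)⟩ = ⟨X(s - t) Y⟩`.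
Bratteli–Robinson II §5.3.1. [folklore] -/
theorem gibbsState_imagTimeEvolve_mul_imagTimeEvolve (β : ℝ) (H : Matrix n n ℂ) (s t : ℂ)
    (X Y : Matrix n n ℂ) :
    gibbsState β H (imagTimeEvolve H s X * imagTimeEvolve H t Y) =
      gibbsState β H (imagTimeEvolve H (s - t) X * Y) := by
  conv_lhs => rw [show s = t + (s - t) by ring, imagTimeEvolve_add, ← imagTimeEvolve_mul,
    gibbsState_imagTimeEvolve]

/-- **The KMS condition (imaginary-time form)**: `⟨X Y⟩ = ⟨Y(β) X⟩` for the Gibbs state at inverse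
temperature `β` (cyclicity of the trace). Bratteli–Robinson II §5.3.1 (Gibbs states are
`β`-KMS states); BGM 2006 §1.2 (antiperiodicity of `S` in `x₀`). [cite: BratteliRobinsonII1997, §5.3.1] -/
theorem gibbsState_mul_eq_gibbsState_imagTimeEvolve_mul (β : ℝ) (H X Y : Matrix n n ℂ) :
    gibbsState β H (X * Y) = gibbsState β H (imagTimeEvolve H (β : ℂ) Y * X) := by
  rw [gibbsState_apply, gibbsState_apply, imagTimeEvolve]
  congr 1
  have hW : gibbsWeight β H * exp ((β : ℂ) • H) = 1 := by
    rw [gibbsWeight, neg_smul]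
    exact exp_neg_smul_mul_exp_smul H β
  have hW' : exp (-((β : ℂ) • H)) = gibbsWeight β H := by rw [gibbsWeight, neg_smul]
  have key : gibbsWeight β H * (exp ((β : ℂ) • H) * Y * exp (-((β : ℂ) • H)) * X) =
      Y * gibbsWeight β H * X := by
    rw [hW', show gibbsWeight β H * (exp ((β : ℂ) • H) * Y * gibbsWeight β H * X) =
      (gibbsWeight β H * exp ((β : ℂ) • H)) * Y * gibbsWeight β H * X by simp only [Matrix.mul_assoc],
      hW, Matrix.one_mul]
  rw [key, Matrix.trace_mul_cycle Y (gibbsWeight β H) X, Matrix.trace_mul_comm (X * Y)]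

/-! ### The time-ordered two-point function -/

/-- (Dot-notation extension of Mathlib's `Matrix`.) The **finite-temperature time-ordered
two-point (Schwinger) function** of the operators `A` (at time `x₀`) and `B` (at time `y₀`) with
the FERMIONIC ordering sign: `⟨T A(x₀) B(y₀)⟩ = ⟨A(x₀) B(y₀)⟩` if `x₀ > y₀` and `-⟨B(y₀) A(x₀)⟩` if
`x₀ ≤ y₀` — BGM's `S(𝐱,σ,-;𝐲,σ',+)` for `A = a⁻_{x⃗σ}`, `B = a⁺_{y⃗σ'}` (eqs. (1.2)–(1.3), with the
equal-time convention of footnote 1: creation operators to the left).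
[cite: BenfattoGiulianiMastropietro2006, §1.2 (1.2)–(1.3)] -/
def schwingerTwoPoint (β : ℝ) (H A B : Matrix n n ℂ) (x₀ y₀ : ℝ) : ℂ :=
  if y₀ < x₀ then gibbsState β H (imagTimeEvolve H x₀ A * imagTimeEvolve H y₀ B)
  else -gibbsState β H (imagTimeEvolve H y₀ B * imagTimeEvolve H x₀ A)

/-- The `x₀ > y₀` branch. [folklore] -/
theorem schwingerTwoPoint_of_lt (β : ℝ) (H A B : Matrix n n ℂ) {x₀ y₀ : ℝ} (h : y₀ < x₀) :
    schwingerTwoPoint β H A B x₀ y₀ = gibbsState β H (imagTimeEvolve H x₀ A * imagTimeEvolve H y₀ B) :=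
  if_pos h

/-- The `x₀ ≤ y₀` branch. [folklore] -/
theorem schwingerTwoPoint_of_le (β : ℝ) (H A B : Matrix n n ℂ) {x₀ y₀ : ℝ} (h : x₀ ≤ y₀) :
    schwingerTwoPoint β H A B x₀ y₀ =
      -gibbsState β H (imagTimeEvolve H y₀ B * imagTimeEvolve H x₀ A) :=
  if_neg (not_lt.mpr h)

/-- **Equal times**: `S(x₀, x₀) = -⟨B A⟩` (creation operator to the left, BGM footnote 1; for
`A = c_{x⃗σ}`, `B = c†_{y⃗σ'}` this is minus the thermal two-point function `⟨c†c⟩`).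
[cite: BenfattoGiulianiMastropietro2006, §1.2 footnote 1] -/
theorem schwingerTwoPoint_self (β : ℝ) (H A B : Matrix n n ℂ) (x₀ : ℝ) :
    schwingerTwoPoint β H A B x₀ x₀ = -gibbsState β H (B * A) := by
  rw [schwingerTwoPoint_of_le β H A B le_rfl, ← imagTimeEvolve_mul, gibbsState_imagTimeEvolve]

/-- **Time-translation invariance**: `S` is a function of `x₀ - y₀`.
BGM 2006 §1.2 ("`S₀(𝐱)` is a function of `x₀`"). [cite: BenfattoGiulianiMastropietro2006, §1.2] -/
theorem schwingerTwoPoint_eq_sub (β : ℝ) (H A B : Matrix n n ℂ) (x₀ y₀ : ℝ) :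
    schwingerTwoPoint β H A B x₀ y₀ = schwingerTwoPoint β H A B (x₀ - y₀) 0 := by
  by_cases h : y₀ < x₀
  · rw [schwingerTwoPoint_of_lt β H A B h, schwingerTwoPoint_of_lt β H A B (sub_pos.mpr h),
      gibbsState_imagTimeEvolve_mul_imagTimeEvolve, gibbsState_imagTimeEvolve_mul_imagTimeEvolve,
      Complex.ofReal_sub, Complex.ofReal_zero, sub_zero]
  · rw [schwingerTwoPoint_of_le β H A B (not_lt.mp h),
      schwingerTwoPoint_of_le β H A B (sub_nonpos.mpr (not_lt.mp h)),
      gibbsState_imagTimeEvolve_mul_imagTimeEvolve, gibbsState_imagTimeEvolve_mul_imagTimeEvolve,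
      Complex.ofReal_sub, Complex.ofReal_zero, zero_sub, neg_sub]

/-- **Antiperiodicity (KMS)**: for `0 < x₀ - y₀ ≤ β`, `S(x₀ - β, y₀) = -S(x₀, y₀)` — the Schwinger
function is antiperiodic of period `β` in the time difference (fermionic KMS condition).
BGM 2006 §1.2 ("antiperiodic of period `β`"); Bratteli–Robinson II §5.3.1.
[cite: BenfattoGiulianiMastropietro2006, §1.2] -/
theorem schwingerTwoPoint_sub_period (β : ℝ) (H A B : Matrix n n ℂ) {x₀ y₀ : ℝ} (h1 : y₀ < x₀)
    (h2 : x₀ - β ≤ y₀) :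
    schwingerTwoPoint β H A B (x₀ - β) y₀ = -schwingerTwoPoint β H A B x₀ y₀ := by
  rw [schwingerTwoPoint_of_le β H A B h2, schwingerTwoPoint_of_lt β H A B h1,
    gibbsState_mul_eq_gibbsState_imagTimeEvolve_mul β H (imagTimeEvolve H x₀ A), ← imagTimeEvolve_add,
    gibbsState_imagTimeEvolve_mul_imagTimeEvolve, gibbsState_imagTimeEvolve_mul_imagTimeEvolve,
    show ((y₀ : ℝ) : ℂ) - ((x₀ - β : ℝ) : ℂ) = (β : ℂ) + (y₀ : ℂ) - (x₀ : ℂ) by push_cast; ring]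

end Matrix

/-! ### Lattice fermions: the free closed form and the Hubbard model -/

namespace Literature.MathematicalPhysics.QuantumLattice

open Literature.Probability.LatticeModels

section Free

variable {ι : Type*} [LinearOrder ι] [Fintype ι]

/-- **The free propagator in finite volume (BGM (1.4), position space).** For a Hermitian one-body
matrix `h` and real `β`, the time-ordered two-point function of the ideal Fermi gas `dΓ(h)` is
`S₀(x₀, j; y₀, i) = [e^{-x₀h}(1+e^{-βh})⁻¹e^{y₀h}]_{ji}` for `x₀ > y₀` and
`-[e^{-x₀h}(1+e^{βh})⁻¹e^{y₀h}]_{ji}` for `x₀ ≤ y₀` (in the eigenbasis of `h`: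
`e^{-τε}/(1+e^{-βε})` resp. `-e^{-τε}/(1+e^{βε})`, `τ = x₀ - y₀` — the two branches of (1.4),
antiperiodic in `τ`). BGM 2006 §1.2 (1.4); Bratteli–Robinson II §5.2.4.
[cite: BenfattoGiulianiMastropietro2006, §1.2 (1.4)] -/
theorem schwingerTwoPoint_dGamma_annihilation_creation {h : Matrix ι ι ℂ} (hh : h.IsHermitian)
    (β : ℝ) (i j : ι) (x₀ y₀ : ℝ) :
    Matrix.schwingerTwoPoint β (dGamma h) (annihilation j) (creation i) x₀ y₀ =
      if y₀ < x₀ then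
        (exp (-((x₀ : ℂ) • h)) * (1 + exp (-((β : ℂ) • h)))⁻¹ * exp ((y₀ : ℂ) • h)) j i
      else -(exp (-((x₀ : ℂ) • h)) * (1 + exp ((β : ℂ) • h))⁻¹ * exp ((y₀ : ℂ) • h)) j i := by
  by_cases hlt : y₀ < x₀
  · rw [Matrix.schwingerTwoPoint_of_lt _ _ _ _ hlt, if_pos hlt]
    exact thermalCorr_dGamma_evolve_annihilation_creation hh β (x₀ : ℂ) (y₀ : ℂ) i j
  · rw [Matrix.schwingerTwoPoint_of_le _ _ _ _ (not_lt.mp hlt), if_neg hlt]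
    exact congrArg Neg.neg (thermalCorr_dGamma_evolve_creation_annihilation hh β (x₀ : ℂ) (y₀ : ℂ) i j)

end Free

section HubbardTorus

/-- **The two-point Schwinger function of the 2D Hubbard model on the torus**
`S^{β,L}(𝐱, σ, -; 𝐲, σ', +) = ⟨T a⁻_{𝐱σ} a⁺_{𝐲σ'}⟩_{β,L}`, `𝐱 = (x₀, x⃗)`, with the grand-canonical
Hamiltonian `H(1,U) - μN` on `(ℤ/Lℤ)²` and the imaginary-time fields `a^± = e^{Hx₀}c^±e^{-Hx₀}`
(BGM (1.2)–(1.3), in the tree's normalisation of `HubbardFermiLiquid.lean`: hopping `t = 1`, sites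
of `ℤ²` read modulo `L`; junk value `0` for `L = 0`). This is the object of BGM's Theorem 1.1; the
tree's `hubbardThermalTwoPoint` is (minus) its equal-time value
(`hubbardSchwingerTwoPoint_self`). [cite: BenfattoGiulianiMastropietro2006, §1.2 (1.2)–(1.3)] -/
def hubbardSchwingerTwoPoint (β U μ : ℝ) (L : ℕ) (x₀ : ℝ) (x : Site 2) (σ : Fin 2) (y₀ : ℝ)
    (y : Site 2) (σ' : Fin 2) : ℂ :=
  if hL : L = 0 then 0
  else
    haveI : NeZero L := ⟨hL⟩
    Matrix.schwingerTwoPoint β (hubbardTorusWith 2 L 1 U μ)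
      (annihilation (orb (FermionTorus.ofTorusSite (Torus.proj L x)) σ))
      (creation (orb (FermionTorus.ofTorusSite (Torus.proj L y)) σ')) x₀ y₀

/-- `hubbardSchwingerTwoPoint` unfolded for `L ≠ 0`. [folklore] -/
theorem hubbardSchwingerTwoPoint_eq (β U μ : ℝ) {L : ℕ} [NeZero L] (x₀ : ℝ) (x : Site 2) (σ : Fin 2)
    (y₀ : ℝ) (y : Site 2) (σ' : Fin 2) :
    hubbardSchwingerTwoPoint β U μ L x₀ x σ y₀ y σ' =
      Matrix.schwingerTwoPoint β (hubbardTorusWith 2 L 1 U μ)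
        (annihilation (orb (FermionTorus.ofTorusSite (Torus.proj L x)) σ))
        (creation (orb (FermionTorus.ofTorusSite (Torus.proj L y)) σ')) x₀ y₀ := by
  rw [hubbardSchwingerTwoPoint, dif_neg (NeZero.ne L)]

/-- **Equal times: the Schwinger function is minus the thermal two-point function**,
`S^{β,L}((x₀,x⃗),σ,-;(x₀,y⃗),σ',+) = -⟨c†_{y⃗σ'} c_{x⃗σ}⟩_{β,L}` (creation to the left at equal times,
BGM footnote 1). [cite: BenfattoGiulianiMastropietro2006, §1.2 footnote 1] -/
theorem hubbardSchwingerTwoPoint_self (β U μ : ℝ) (L : ℕ) (x₀ : ℝ) (x y : Site 2) (σ σ' : Fin 2) :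
    hubbardSchwingerTwoPoint β U μ L x₀ x σ x₀ y σ' = -hubbardThermalTwoPoint β U μ L y x σ' σ := by
  by_cases hL : L = 0
  · simp [hubbardSchwingerTwoPoint, hubbardThermalTwoPoint, hL]
  · haveI : NeZero L := ⟨hL⟩
    rw [hubbardSchwingerTwoPoint_eq, Matrix.schwingerTwoPoint_self, hubbardThermalTwoPoint, dif_neg hL]
    rfl

/-- **Time-translation invariance**: `S^{β,L}` depends on the times only through `x₀ - y₀`.
BGM 2006 §1.2. [cite: BenfattoGiulianiMastropietro2006, §1.2] -/
theorem hubbardSchwingerTwoPoint_eq_sub (β U μ : ℝ) (L : ℕ) (x₀ : ℝ) (x : Site 2) (σ : Fin 2)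
    (y₀ : ℝ) (y : Site 2) (σ' : Fin 2) :
    hubbardSchwingerTwoPoint β U μ L x₀ x σ y₀ y σ' =
      hubbardSchwingerTwoPoint β U μ L (x₀ - y₀) x σ 0 y σ' := by
  by_cases hL : L = 0
  · simp [hubbardSchwingerTwoPoint, hL]
  · haveI : NeZero L := ⟨hL⟩
    rw [hubbardSchwingerTwoPoint_eq, hubbardSchwingerTwoPoint_eq, Matrix.schwingerTwoPoint_eq_sub]

/-- **Antiperiodicity in the time difference with period `β` (fermionic KMS)**: for
`0 < x₀ - y₀ ≤ β`, `S^{β,L}(x₀ - β, …; y₀, …) = -S^{β,L}(x₀, …; y₀, …)`. BGM 2006 §1.2 ("antiperiodic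
of period `β`"); Bratteli–Robinson II §5.3.1. [cite: BenfattoGiulianiMastropietro2006, §1.2] -/
theorem hubbardSchwingerTwoPoint_sub_period (β U μ : ℝ) (L : ℕ) {x₀ y₀ : ℝ} (h1 : y₀ < x₀)
    (h2 : x₀ - β ≤ y₀) (x : Site 2) (σ : Fin 2) (y : Site 2) (σ' : Fin 2) :
    hubbardSchwingerTwoPoint β U μ L (x₀ - β) x σ y₀ y σ' =
      -hubbardSchwingerTwoPoint β U μ L x₀ x σ y₀ y σ' := by
  by_cases hL : L = 0
  · simp [hubbardSchwingerTwoPoint, hL]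
  · haveI : NeZero L := ⟨hL⟩
    rw [hubbardSchwingerTwoPoint_eq, hubbardSchwingerTwoPoint_eq,
      Matrix.schwingerTwoPoint_sub_period _ _ _ _ h1 h2]

/-- **The free propagator of the Hubbard torus (BGM (1.4) in position space, finite `L`)**: at
`U = 0`, with the one-body matrix `h = hubbardOneBody (fermionTorusGraph 2 L) 1 μ`,
`S₀^{β,L}((x₀,x⃗),σ,-;(y₀,y⃗),σ',+) = [e^{-x₀h}(1+e^{-βh})⁻¹e^{y₀h}]_{(x⃗σ),(y⃗σ')}` for `x₀ > y₀` and
`-[e^{-x₀h}(1+e^{βh})⁻¹e^{y₀h}]_{(x⃗σ),(y⃗σ')}` for `x₀ ≤ y₀` (diagonalising `h` by plane waves gives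
the momentum sum (1.4)). BGM 2006 §1.2 (1.4). [cite: BenfattoGiulianiMastropietro2006, §1.2 (1.4)] -/
theorem hubbardSchwingerTwoPoint_zero_interaction (β μ : ℝ) {L : ℕ} [NeZero L] (x₀ : ℝ) (x : Site 2)
    (σ : Fin 2) (y₀ : ℝ) (y : Site 2) (σ' : Fin 2) :
    hubbardSchwingerTwoPoint β 0 μ L x₀ x σ y₀ y σ' =
      if y₀ < x₀ then
        (exp (-((x₀ : ℂ) • hubbardOneBody (fermionTorusGraph 2 L) 1 μ)) *
            (1 + exp (-((β : ℂ) • hubbardOneBody (fermionTorusGraph 2 L) 1 μ)))⁻¹ *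
          exp ((y₀ : ℂ) • hubbardOneBody (fermionTorusGraph 2 L) 1 μ))
          (orb (FermionTorus.ofTorusSite (Torus.proj L x)) σ)
          (orb (FermionTorus.ofTorusSite (Torus.proj L y)) σ')
      else
        -(exp (-((x₀ : ℂ) • hubbardOneBody (fermionTorusGraph 2 L) 1 μ)) *
            (1 + exp ((β : ℂ) • hubbardOneBody (fermionTorusGraph 2 L) 1 μ))⁻¹ *
          exp ((y₀ : ℂ) • hubbardOneBody (fermionTorusGraph 2 L) 1 μ))
          (orb (FermionTorus.ofTorusSite (Torus.proj L x)) σ)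
          (orb (FermionTorus.ofTorusSite (Torus.proj L y)) σ') := by
  rw [hubbardSchwingerTwoPoint_eq, hubbardTorusWith, hamiltonianWith_zero_eq_dGamma]
  convert schwingerTwoPoint_dGamma_annihilation_creation (isHermitian_hubbardOneBody _ 1 μ) β
    (orb (FermionTorus.ofTorusSite (Torus.proj L y)) σ')
    (orb (FermionTorus.ofTorusSite (Torus.proj L x)) σ) x₀ y₀

end HubbardTorus

end Literature.MathematicalPhysics.QuantumLattice

end
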